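import Mathlib
import HarnessLib
import HarnessLib.Audit
import Summits.CriticalPhenomena.Statement

/-!
Route: SAWQuantumGravity

CLOSED (superseded) 2026-08-15T12:52:51Z by planner-CriticalPhenomena-route-CriticalPhenomena-SAWQuantumGravity-0 — reason: superseded:route-CriticalPhenomena-SAWWeldingIdentification — superseded by route-CriticalPhenomena-SAWWeldingIdentification — note: route-repair verdict (planner, 2026-08-15): CLOSE as superseded by route-CriticalPhenomena-SAWWeldingIdentification (LQG/zipper MECHANISM transplanted to Z^2, typed without LQG objects) and route-CriticalPhenomena-SAWHexUniversality (same transfer shape, nearer environment, keeps the shared typed sh. The file is kept as the record of this route; refuted decls are indexed as negative knowledge (`ledger negatives`).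

It suffices to show X4 = (E) ∧ (R) [quantum-gravity dictionary + environment removal] (payload has
no brief; this is the
deliberate "widen" line bringing random planar geometry / Liouville quantum gravity to bear):
 (E) EmbeddedMapLimit: the critical SAW on a random planar quadrangulation of the disc with two
marked boundary points,
     conformally embedded into (Ω; a, b) (Tutte / harmonic embedding), converges in (annealed) law
on CurveClass ℂ to chordal
     SLE_{8/3} from a to b — the Euclidean-embedded upgrade of Gwynne–Miller (arXiv:1608.00956 Thm
1.1: SAW on the glued
     UIHPQ_S → chordal SLE_{8/3} on the weight-4 √(8/3)-quantum wedge,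
Gromov–Hausdorff–Prokhorov–uniform sense);
 (R) EnvironmentRemoval: in every Dobrushin domain the square-lattice critical SAW law
(Literature.Probability.RandomPlanarGeometry.SAW.law) and the annealed
     embedded-map SAW law at comparable mesh are asymptotically equal in law (test integrals differ
by o(1)).
DICTIONARY (explicit): KPZ/DDG — SAW is the c = 0, κ = 8/3, γ = √(8/3) model; on the map side the
SAW is an exact
gluing interface of two independent uniform half-planar maps (Duplantier–Sheffield / GM 'peeling =
gluing'), which is
what makes (E) provable there; the Euclidean lattice has no such factorisation, and (R) is precisely
the missing
universality across conformally embedded planar graphs.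

Lean: same typed shell as Route SAWHexUniversality (comparison family Q, here INTENDED := annealed
law of the
Tutte-embedded SAW-decorated quadrangulation at mesh δ; deduplicated item):
∀ (D : Literature.Probability.RandomPlanarGeometry.DobrushinDomain) (a b : ℝ →
Literature.Probability.LatticeModels.Site 2),
Literature.Probability.RandomPlanarGeometry.SAW.IsEndpointApprox D a b → ∃ Q : ℝ →
MeasureTheory.Measure (Literature.Probability.RandomPlanarGeometry.CurveClass ℂ), (∃ Γ : (NNReal →
ℝ) → Literature.Probability.RandomPlanarGeometry.CurveClass ℂ,
Literature.Probability.RandomPlanarGeometry.IsSLECurve ((8 : NNReal) / 3) D Γ ∧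
Literature.Probability.RandomPlanarGeometry.TendstoLaw (fun (_ : ℝ) (x :
Literature.Probability.RandomPlanarGeometry.CurveClass ℂ) => x) Q Γ
Literature.Probability.Process.preWienerMeasure) ∧ (∀ f : BoundedContinuousFunction
(Literature.Probability.RandomPlanarGeometry.CurveClass ℂ) ℝ, Filter.Tendsto (fun δ => (∫ γ, f
γ.curve ∂(Literature.Probability.RandomPlanarGeometry.SAW.law D.carrier δ (a δ) (b δ))) - ∫ x, f x
∂(Q δ)) (nhdsWithin 0 (Set.Ioi 0)) (nhds 0))

Rationale: WHY THIS LINE. SLE_{8/3} IS already the proved scaling limit of a self-avoiding walk — on random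
quadrangulations
(Gwynne–Miller, Ann. Sci. ÉNS 2021, arXiv:1608.00956 Thm 1.1, with arXiv:1608.00955 for the metric
gluing), because there
the SAW-decorated map factorises into two independent UIHPQ_S glued along their boundary and the
Brownian half-plane /
√(8/3)-LQG theory (Miller–Sheffield) identifies the gluing interface as SLE_{8/3}. Two further
pieces of technology
make a Euclidean statement out of this: convergence of embedded random planar maps to LQG under the
Tutte embedding
(Gwynne–Miller–Sheffield arXiv:1705.11161, mated-CRT maps) and under the Cardy embedding jointly
with the decorating
statistical model (Holden–Sun arXiv:1905.13207: uniform triangulations + percolation → √(8/3)-LQG +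
CLE₆). The thesis
isolates (E), the SAW analogue of Holden–Sun (plausible with existing tools), from (R), a
universality principle
"the chordal SAW limit depends only on the conformal structure of the embedded graph sequence" —
speculative, no
known mechanism, but a sharply posed question that would also settle Route SAWHexUniversality's r2.
Areas imported:
Liouville quantum gravity, random planar maps, mating of trees.

RANKED CRUXES:
 r2 EnvironmentRemoval (informal; hardest, most informative): ℤ² SAW law vs annealed Tutte-embedded
random-map SAW law
    in the same Dobrushin domain are asymptotically equal on bounded continuous test functions of
the curve.
 r3 EmbeddedMapLimit (informal): (E) above; finite-volume (disc with two marked boundary vertices,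
Boltzmann
    quadrangulation decorated by a boundary-to-boundary SAW = two independent quadrangulations of
the disc glued along a
    boundary arc) version of GM16 Thm 1.1 under the Tutte embedding normalised to send the marked
points to a, b.
 r4 QuenchedEmbeddedLimit (informal, intermediate between r3 and r2): the same convergence for a.e.
realisation of the
    map (quenched), i.e. the SLE_{8/3} limit is independent of the LQG environment — the continuum
fact "SLE_{8/3}
    independent of the field" made discrete.
 support GwynneMiller2016Fact (cite item): GM16 Thm 1.1 as a Literature named fact (GHPU
convergence), hypothesis only.
 Assembly: the shared typed shell TransferShape → SAWScalingLimit (item of Route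
SAWHexUniversality).

KILL CRITERIA. ¬r2 with r3 proved = non-universality between random and periodic environments:
closes the route, no
bearing on the conjunct. r3 refuted (embedded limit not Euclidean SLE_{8/3}) would contradict
GM16+GMS and is not
expected. This route is rank-last for staffing; it exists so that LQG specialists have an attach
point.
NOT DECOMPOSED YET: which embedding (Tutte vs Cardy vs circle packing); annealed vs quenched
topology; the KPZ exponent
bookkeeping (5/8 ↔ quantum boundary exponent); any typed LQG object (Literature has none: definition
request filed
with low priority).
Sources: arXiv:1608.00956 (Thm 1.1), arXiv:1608.00955, arXiv:1705.11161, arXiv:1905.13207,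
DuplantierSheffield2011 (KPZ),
LawlerSchrammWerner2004SAW.

History (route lifecycle, newest last):
- 2026-08-15T12:52:52Z · CLOSED superseded — superseded:route-CriticalPhenomena-SAWWeldingIdentification (planner-CriticalPhenomena-route-CriticalPhenomena-SAWQuantum)

sub-problem: SAWScalingLimit · status: closed(superseded) · opened planner-plan-CriticalPhenomena-SAWScalingLimit-0 2026-08-13T19:13:20Z · rev 0 · ledger route-CriticalPhenomena-SAWQuantumGravity
GENERATED by the gate from the ledger (D-0016/17). Provers cite these decls: `theorem foo : Summit.CriticalPhenomena.SAWScalingLimit.Theses.SAWQuantumGravity.<Decl> := …` in Summits/CriticalPhenomena/SAWScalingLimit/Theorems/<Name>.lean.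
-/

namespace Summit.CriticalPhenomena.SAWScalingLimit.Theses.SAWQuantumGravity

open scoped BigOperators Topology Manifold Classical MeasureTheory ProbabilityTheory Matrix InnerProductSpace ComplexConjugate ContinuousMap
open Filter Set Function TopologicalSpace MeasureTheory

attribute [summit_statement] _root_.SAWScalingLimit

-- item stmt-CriticalPhenomena-0814 · crux · rank 2 · closed · moot by None · by planner — informal only, no Lean statement yet:
--   [crux] r2 (hardest, most informative; informal — no LQG/planar-map objects in the library):
--   environment removal — for every Dobrushin domain (Ω; a, b), square-lattice endpoint approximation,
--   and bounded continuous f on CurveClass ℂ, the test integral of f under the critical Z^2 SAW law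
--   Literature.Probability.RandomPlanarGeometry.SAW.law at mesh δ and under the ANNEALED law of the
--   Tutte-embedded boundary-to-boundary SAW on a SAW-decorated Boltzmann quadrangulation of the disc
--   with ≍ δ^{-4} faces (marked boundary vertices sent to a, b), differ by o(1) as δ → 0+. Universality
--   across conformally e

-- item stmt-CriticalPhenomena-0815 · support · rank 3 · closed · moot by None · by planner — informal only, no Lean statement yet:
--   [crux] r3 (informal): Euclidean upgrade of Gwynne–Miller arXiv:1608.00956 Thm 1.1 — the
--   boundary-to-boundary SAW on a SAW-decorated Boltzmann quadrangulation of the disc (equivalently: two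
--   independent quadrangulations of the disc glued along a boundary arc, the gluing line being the SAW),
--   embedded in (Ω; a, b) by the Tutte/harmonic embedding normalised at the marked points, converges in
--   annealed law on CurveClass ℂ to chordal SLE_{8/3} in Ω from a to b, jointly with convergence of the
--   rescaled vertex counting measure to the √(8/3)-LQG disc measure. Tools: GM16 (GHPU limit),
--   Gwynne–Miller–Sheff

-- item stmt-CriticalPhenomena-0816 · support · rank 4 · closed · moot by None · by planner — informal only, no Lean statement yet:
--   [crux] r4 (informal): quenched version of r3 — for a.e. realisation of the infinite-volume random
--   quadrangulation environment (suitably localised to (Ω; a, b)), the conditional law of the embedded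
--   SAW given the map converges to chordal SLE_{8/3}; i.e. the limit curve is independent of the LQG
--   environment (discrete counterpart of the independence of SLE_{8/3} and the free field in the GM16
--   limit object). Intermediate between r3 (annealed) and r2 (deterministic lattice).

/-- item stmt-CriticalPhenomena-0802 · support · rank 9 · closed · moot by None · by planner
[support] typed shell of X3 = (H) ∧ (U): for every Dobrushin domain and ℤ² endpoint approximation
there is a comparison family Q : ℝ → Measure (CurveClass ℂ) (INTENDED: the hexagonal critical SAW
laws in the same domain, defn HexSAWLaw) which converges in law to a chordal SLE_{8/3} curve Γ (this
is (H)) and whose test integrals differ from those of the ℤ² SAW law by o(1) as δ → 0+ (this is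
(U)). As typed (∃ Q) it is implied by the conjunct (take Q = SLE law), so it carries no difficulty
by itself; it fixes the shape the informal cruxes r2–r5 must instantiate. -/
@[route_item "route-CriticalPhenomena-SAWQuantumGravity"]
def TransferShape : Prop :=
  ∀ (D : Literature.Probability.RandomPlanarGeometry.DobrushinDomain) (a b : ℝ → Literature.Probability.LatticeModels.Site 2), Literature.Probability.RandomPlanarGeometry.SAW.IsEndpointApprox D a b → ∃ Q : ℝ → MeasureTheory.Measure (Literature.Probability.RandomPlanarGeometry.CurveClass ℂ), (∃ Γ : (NNReal → ℝ) → Literature.Probability.RandomPlanarGeometry.CurveClass ℂ, Literature.Probability.RandomPlanarGeometry.IsSLECurve ((8 : NNReal) / 3) D Γ ∧ Literature.Probability.RandomPlanarGeometry.TendstoLaw (fun (_ : ℝ) (x : Literature.Probability.RandomPlanarGeometry.CurveClass ℂ) => x) Q Γ Literature.Probability.Process.preWienerMeasure) ∧ (∀ f : BoundedContinuousFunction (Literature.Probability.RandomPlanarGeometry.CurveClass ℂ) ℝ, Filter.Tendsto (fun δ => (∫ γ, f γ.curve ∂(Literature.Probability.RandomPlanarGeometry.SAW.law D.carrier δ (a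 δ) (b δ))) - ∫ x, f x ∂(Q δ)) (nhdsWithin 0 (Set.Ioi 0)) (nhds 0))

/-- item stmt-CriticalPhenomena-0803 · assembly · rank 1 · closed · moot by None · by planner
[assembly] TransferShape → SAWScalingLimit: given Γ SLE_{8/3} with TendstoLaw id Q Γ
preWienerMeasure and ∫ f∘curve d law_δ − ∫ f dQ_δ → 0, conclude TendstoLaw curve law Γ
preWienerMeasure (add the two limits), AEMeasurable automatic
(Literature.Probability.RandomPlanarGeometry.SAW.aemeasurable_curve), hence ConvergesInLawToSLE
(8/3). -/
@[route_item "route-CriticalPhenomena-SAWQuantumGravity"]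
def Assembly : Prop :=
  (∀ (D : Literature.Probability.RandomPlanarGeometry.DobrushinDomain) (a b : ℝ → Literature.Probability.LatticeModels.Site 2), Literature.Probability.RandomPlanarGeometry.SAW.IsEndpointApprox D a b → ∃ Q : ℝ → MeasureTheory.Measure (Literature.Probability.RandomPlanarGeometry.CurveClass ℂ), (∃ Γ : (NNReal → ℝ) → Literature.Probability.RandomPlanarGeometry.CurveClass ℂ, Literature.Probability.RandomPlanarGeometry.IsSLECurve ((8 : NNReal) / 3) D Γ ∧ Literature.Probability.RandomPlanarGeometry.TendstoLaw (fun (_ : ℝ) (x : Literature.Probability.RandomPlanarGeometry.CurveClass ℂ) => x) Q Γ Literature.Probability.Process.preWienerMeasure) ∧ (∀ f : BoundedContinuousFunction (Literature.Probability.RandomPlanarGeometry.CurveClass ℂ) ℝ, Filter.Tendsto (fun δ => (∫ γ, f γ.curve ∂(Literature.Probability.RandomPlanarGeometry.SAW.law D.carrier δ (a δ) (b δ))) - ∫ x, f x ∂(Q δ)) (nhdsWithin 0 (Set.Ioi 0)) (nhds 0))) → Literature.Probability.RandomPlanarGeometry.SAW.SAWScalingLimit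

end Summit.CriticalPhenomena.SAWScalingLimit.Theses.SAWQuantumGravity
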